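import Summits.CriticalPhenomena.CardyFormulaZ2.Theorems.CardySelfDualSegmentUniformMarginalityMirrorDefs

/-!
# The mirror pairing of pivotal corner events (`λ⁺ = λ⁻` as an exact identity)

Sub-goal `real_isPivotal_insert_eq_real_mirror` of line `Sketch` for the crux `UniformMarginality`
(stmt-CriticalPhenomena-5472, route `CardySelfDualSegment`), over the vocabulary of
`…UniformMarginalityMirrorDefs.lean` (the corner mirror `Ŝ_v = cornerMirror v`, the mirror event
`A^{Ŝ_v} = mirrorEvent v A`).

* `isPivotal_mirror_iff` — **pivotality is transported by the mirror**: for a lattice configuration `ω`,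
  the edge `cornerEdge (u, j)` is pivotal for `A` in `ω` iff its mirror image `cornerEdge (σ_v u, j)` is
  pivotal for `A^{Ŝ_v}` in `Ŝ_v ω` (the mirror exchanges "switch on" and "switch off",
  `cornerMirror_insert` / `cornerMirror_diff_singleton`, and `1_A(ω) = 1 − 1_{A^Ŝ}(Ŝ ω)`).
* `isPivotal_north_insert_east_iff` — at the mirror's own corner: `N_v` is pivotal for `A` with `E_v`
  forced OPEN iff `N_v` is pivotal for `A^{Ŝ_v}` in `Ŝ_v ω` with `E_v` forced CLOSED.
* `real_isPivotal_insert_eq_real_mirror` (registered stub) — integrating against the `Ŝ_v`-invariant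
  law `M_t` (`cornerPercolation_map_cornerMirror`):
  `M_t{N_v pivotal for A, E_v forced open} = M_t{N_v pivotal for A^{Ŝ_v}, E_v forced closed}`.

With `integral_russoIntegrand_eq_half_pivotal_sub` (`…MirrorIntegrand.lean`) this turns the Russo census
`½ Σ_v E_t[(1 − 2c_v)𝟙{N_v piv}]` into `¼ Σ_v [Π_v(A) − Π_v(A^{Ŝ_v})]`, `Π_v(B) = M_t{N_v pivotal for B
with E_v closed}` — the antisymmetrisation of ONE functional under the corner mirrors (the exact form of
the cancellation `λ⁺ = λ⁻` of the route text; idea card `and-or-mirror-stress`).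
-/

noncomputable section

namespace Summit.CriticalPhenomena.CardyFormulaZ2.Cruxes.UniformMarginality.HeatFlow

open MeasureTheory Literature.Probability.Percolation Literature.Probability.LatticeModels
  Literature.Probability.RandomPlanarGeometry

/-! ## §1 Pivotality is transported by the mirror -/

/-- `Xor (¬ q) (¬ p) ↔ Xor p q`. -/
private theorem xor_not_not_comm (p q : Prop) : Xor (¬ q) (¬ p) ↔ Xor p q := by
  unfold Xor
  tauto

/-- **Pivotality is transported by the corner mirror**: for a lattice configuration `ω`, the edge
`cornerEdge (u, j)` is pivotal for `A` in `ω` iff `cornerEdge (σ_v u, j)` is pivotal for the mirror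
event `A^{Ŝ_v}` in `Ŝ_v ω`. -/
theorem isPivotal_mirror_iff (v : Site 2) (A : Set (BondConfig (Site 2))) {ω : BondConfig (Site 2)}
    (hω : ω ⊆ (zdGraph 2).edgeSet) (u : Site 2) (j : Fin 2) :
    IsPivotal (mirrorEvent v A) (cornerEdge (antidiagReflect v u, j)) (cornerMirror v ω) ↔
      IsPivotal A (cornerEdge (u, j)) ω := by
  have h1 : insert (cornerEdge (antidiagReflect v u, j)) (cornerMirror v ω) =
      cornerMirror v (ω \ {cornerEdge (u, j)}) := (cornerMirror_diff_singleton v ω u j).symm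
  have h2 : cornerMirror v ω \ {cornerEdge (antidiagReflect v u, j)} =
      cornerMirror v (insert (cornerEdge (u, j)) ω) := (cornerMirror_insert v ω u j).symm
  have hdiff : ω \ {cornerEdge (u, j)} ⊆ (zdGraph 2).edgeSet := Set.sdiff_subset.trans hω
  have hins : insert (cornerEdge (u, j)) ω ⊆ (zdGraph 2).edgeSet :=
    Set.insert_subset (Literature.Probability.Percolation.cornerEdge_mem_edgeSet _) hω
  unfold IsPivotal
  rw [h1, h2, mem_mirrorEvent_iff, mem_mirrorEvent_iff, cornerMirror_cornerMirror v hdiff,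
    cornerMirror_cornerMirror v hins]
  exact xor_not_not_comm _ _

/-- **At the mirror's own corner**: for a lattice configuration `ω`, `N_v` is pivotal for `A` with `E_v`
forced open iff `N_v` is pivotal for `A^{Ŝ_v}` in `Ŝ_v ω` with `E_v` forced closed. -/
theorem isPivotal_north_insert_east_iff (v : Site 2) (A : Set (BondConfig (Site 2)))
    {ω : BondConfig (Site 2)} (hω : ω ⊆ (zdGraph 2).edgeSet) :
    IsPivotal A (northEdge v) (insert (eastEdge v) ω) ↔
      IsPivotal (mirrorEvent v A) (northEdge v) (cornerMirror v ω \ {eastEdge v}) := by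
  have hins : insert (eastEdge v) ω ⊆ (zdGraph 2).edgeSet := by
    rw [eastEdge_eq_cornerEdge]
    exact Set.insert_subset (Literature.Probability.Percolation.cornerEdge_mem_edgeSet _) hω
  have key := isPivotal_mirror_iff v A hins v 1
  rw [antidiagReflect_self, ← northEdge_eq_cornerEdge] at key
  rw [← key, eastEdge_eq_cornerEdge, cornerMirror_insert, antidiagReflect_self]

/-- The two pivotal events agree, on lattice configurations, up to the mirror. -/
theorem setOf_isPivotal_insert_inter_eq (v : Site 2) (A : Set (BondConfig (Site 2))) :
    {ω : BondConfig (Site 2) | IsPivotal A (northEdge v) (insert (eastEdge v) ω)} ∩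
        {ω | ω ⊆ (zdGraph 2).edgeSet} =
      cornerMirror v ⁻¹' {ω | IsPivotal (mirrorEvent v A) (northEdge v) (ω \ {eastEdge v})} ∩
        {ω | ω ⊆ (zdGraph 2).edgeSet} := by
  ext ω
  simp only [Set.mem_inter_iff, Set.mem_setOf_eq, Set.mem_preimage]
  constructor
  · rintro ⟨h, hω⟩
    exact ⟨(isPivotal_north_insert_east_iff v A hω).1 h, hω⟩
  · rintro ⟨h, hω⟩
    exact ⟨(isPivotal_north_insert_east_iff v A hω).2 h, hω⟩

/-! ## §2 Measurability -/

/-- Switching a coordinate on is measurable. -/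
private theorem measurable_insert'' (a : Sym2 (Site 2)) :
    Measurable (insert a : BondConfig (Site 2) → BondConfig (Site 2)) :=
  measurable_set_iff.2 fun x => by
    simp only [Set.mem_insert_iff]
    exact measurable_const.or (measurable_set_mem x)

/-- Switching a coordinate off is measurable. -/
private theorem measurable_sdiff_singleton'' (a : Sym2 (Site 2)) :
    Measurable (· \ {a} : BondConfig (Site 2) → BondConfig (Site 2)) :=
  measurable_set_iff.2 fun x => (measurable_set_mem x).and measurable_const

/-- The pivotality event of a measurable event is measurable. -/
private theorem measurableSet_isPivotal'' {A : Set (BondConfig (Site 2))} (hA : MeasurableSet A)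
    (a : Sym2 (Site 2)) : MeasurableSet {S : BondConfig (Site 2) | IsPivotal A a S} := by
  have h1 : MeasurableSet {S : BondConfig (Site 2) | insert a S ∈ A} := measurable_insert'' a hA
  have h2 : MeasurableSet {S : BondConfig (Site 2) | S \ {a} ∈ A} := measurable_sdiff_singleton'' a hA
  have h : {S : BondConfig (Site 2) | IsPivotal A a S} = ({S | insert a S ∈ A} ∩ {S | S \ {a} ∈ A}ᶜ) ∪
      ({S | S \ {a} ∈ A} ∩ {S | insert a S ∈ A}ᶜ) := by
    ext S
    simp only [IsPivotal, Xor, Set.mem_setOf_eq, Set.mem_union, Set.mem_inter_iff, Set.mem_compl_iff]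
  rw [h]
  exact (h1.inter h2.compl).union (h2.inter h1.compl)

/-- `{ω | e pivotal for A in ω ∖ {f}}` is measurable. -/
theorem measurableSet_isPivotal_sdiff {A : Set (BondConfig (Site 2))} (hA : MeasurableSet A)
    (e f : Sym2 (Site 2)) : MeasurableSet {ω : BondConfig (Site 2) | IsPivotal A e (ω \ {f})} :=
  measurable_sdiff_singleton'' f (measurableSet_isPivotal'' hA e)

/-- `{ω | e pivotal for A in insert f ω}` is measurable. -/
theorem measurableSet_isPivotal_insert {A : Set (BondConfig (Site 2))} (hA : MeasurableSet A)
    (e f : Sym2 (Site 2)) : MeasurableSet {ω : BondConfig (Site 2) | IsPivotal A e (insert f ω)} :=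
  measurable_insert'' f (measurableSet_isPivotal'' hA e)

/-! ## §3 The identity -/

/-- Restricting to lattice configurations does not change `M_t`-probabilities. -/
theorem cornerPercolation_real_inter_lattice (t : unitInterval) (X : Set (BondConfig (Site 2))) :
    (cornerPercolation t).real (X ∩ {ω | ω ⊆ (zdGraph 2).edgeSet}) = (cornerPercolation t).real X := by
  refine measureReal_congr ?_
  have hae : ∀ᵐ ω ∂(cornerPercolation t), ω ∈ {ω : BondConfig (Site 2) | ω ⊆ (zdGraph 2).edgeSet} :=
    cornerPercolation_subset_edgeSet t
  filter_upwards [hae] with ω hω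
  exact propext ⟨fun h => h.1, fun h => ⟨h, hω⟩⟩

/-- **The mirror pairing (`λ⁺ = λ⁻`, exact)**: for every measurable event `A`, every vertex `v` and every
`t`, `M_t{N_v pivotal for A with E_v forced open} = M_t{N_v pivotal for A^{Ŝ_v} with E_v forced closed}`
(transport of pivotality by the mirror + `Ŝ_v`-invariance of `M_t`). -/
theorem real_isPivotal_insert_eq_real_mirror : ∀ (t : unitInterval) (A : Set (BondConfig (Site 2))), MeasurableSet A → ∀ v : Site 2, (cornerPercolation t).real {ω | IsPivotal A (northEdge v) (insert (eastEdge v) ω)} = (cornerPercolation t).real {ω | IsPivotal (mirrorEvent v A) (northEdge v) (ω \ {eastEdge v})} := by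
  intro t A hA v
  have hY : MeasurableSet {ω : BondConfig (Site 2) | IsPivotal (mirrorEvent v A) (northEdge v) (ω \ {eastEdge v})} :=
    measurableSet_isPivotal_sdiff (measurableSet_mirrorEvent v hA) _ _
  rw [← cornerPercolation_real_inter_lattice t {ω | IsPivotal A (northEdge v) (insert (eastEdge v) ω)},
    setOf_isPivotal_insert_inter_eq v A, cornerPercolation_real_inter_lattice,
    cornerPercolation_real_preimage_cornerMirror t v hY]

/-- **Corollary — the mirror form of the Russo integrand's two halves**: for measurable `A`,
`M_t{N_v piv A, E_v closed} − M_t{N_v piv A, E_v open} = Π_v(A) − Π_v(A^{Ŝ_v})` with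
`Π_v(B) = M_t{N_v pivotal for B with E_v forced closed}`. -/
theorem real_pivotal_sdiff_sub_insert_eq_mirror (t : unitInterval) {A : Set (BondConfig (Site 2))}
    (hA : MeasurableSet A) (v : Site 2) :
    (cornerPercolation t).real {ω | IsPivotal A (northEdge v) (ω \ {eastEdge v})} -
        (cornerPercolation t).real {ω | IsPivotal A (northEdge v) (insert (eastEdge v) ω)} =
      (cornerPercolation t).real {ω | IsPivotal A (northEdge v) (ω \ {eastEdge v})} -
        (cornerPercolation t).real {ω | IsPivotal (mirrorEvent v A) (northEdge v) (ω \ {eastEdge v})} := by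
  rw [real_isPivotal_insert_eq_real_mirror t A hA v]

end Summit.CriticalPhenomena.CardyFormulaZ2.Cruxes.UniformMarginality.HeatFlow

end
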